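import Summits.QuantumFields.QCD.Theorems.GaussianLinkFramesFrameAPrioriBoundStubCubeSmallBall

/-!
# Crux `FrameAPrioriBound` (stmt-QuantumFields-17374), line `cube-cofactor` — stub
# `stub_cubeAdjugateNikolskii`

NIKOLSKII (reverse Hölder) FOR THE COFACTOR BLOCK on the two-cube fibre: there is an absolute `K > 0`
such that for every torus `L ≥ 4`, mass `m₀`, spectral parameter `z`, sites `x, y`, background `U`
and fibre point `W₀`, the `ℓ¹` colour–spin block `Σ_{a,i,b,j} |adj(H(refit W₀) − z)_{(x,a,i),(y,b,j)}|`
of the adjugate of `H = γ₅ D_W(·; m₀, 1)` satisfies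
`(block at W₀)² ≤ K ∫ (block at W)² dHaar^{⊗E}(W)`.

Proof.  (1) BAND LIMIT: along a one-link curve `t ↦ V[e ↦ κ(t)]` with `T(1)` entries, one cofactor
`adj(H − z)_{pq} = det((H − z) with row q := δ_p)` (`Matrix.adjugate_apply`) is a trigonometric
polynomial of degree `≤ 24` (the replaced row is constant, the others keep the row degrees
`[r.1 = e.1] + [r.1 = e.1 + ê.2]` of `SmallBall.band`; `tp_det`, `sum_rowDegree`), so the block
`ℓ²`-sum `Q = Σ |adj|²` has degree `≤ 48` (`tp_mul`, `tp_star`, `tp_sum`, `SmallBall.fourier`).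
(2) SMALL BALLS: the abstract Haar small-ball theorem `CircleTransport.stub_haarSmallBalls` (with
`exists_diagCircle`, `stub_eulerWord`, `stub_torusSmallBalls ∘ stub_circleEngine`, degree `48`,
`10⁴` listed links `SmallBall.exists_listing`) applied to `G = √Q` gives
`Haar{G ≤ ε G(W₀)} ≤ C ε^c` uniformly; at the scale `ε₀ = (1/(2C))^{1/c}` this is `≤ 1/2`, and
Markov on the complement gives `ε₀² G(W₀)² ≤ 2 ∫ G²`.  (3) `(Σ|adj|)² ≤ 144 Q` and `Q ≤ (Σ|adj|)²`
(Cauchy–Schwarz over the `144` entries), whence `K = 144 · 2 / ε₀²`.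
Sources: folklore (Nikolskii-type inequalities from relative small balls); line card `cube-cofactor`.
-/

noncomputable section

namespace Summit.QuantumFields.QCD.Cruxes.FrameAPrioriBound.CubeCofactor

open scoped BigOperators Matrix
open MeasureTheory Filter Literature.MathematicalPhysics.QuantumFieldTheory
  Literature.MathematicalPhysics.QuantumLattice Literature.Probability.LatticeModels

namespace AdjugateNikolskii

open Complex Polynomial Summit.QuantumFields.QCD.Theorems.SingleLinkLogFlatness SmallBall

variable {L : ℕ}

/-! ### The band limit of the cofactor block along a one-link circle -/

/-- One cofactor of `H(V[e ↦ κ θ]) − z` along a curve with `T(1)` entries lies in `T(24)`: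
`adj_{pq} = det(with row q := δ_p)`, the replaced row is constant and the other rows keep the row
degrees `[r.1 = e.1] + [r.1 = e.1 + ê.2]`, of total `24`. -/
theorem tp_adjugate [NeZero L] (V : GaugeConfig 4 L SU3) (e : Edge 4 L) (κ : ℝ → SU3)
    (hκ : ∀ a b : Fin 3, ∃ p : ℂ[X], p.natDegree ≤ 2 * 1 ∧ ∀ θ : ℝ,
      (κ θ : Matrix (Fin 3) (Fin 3) ℂ) a b = p.eval (cexp (θ * I)) * cexp (-((1 : ℕ) * θ * I)))
    (m₀ : ℝ) (z : ℂ) (p q : TorusSite 4 L × Fin 3 × Fin 4) :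
    ∃ P : ℂ[X], P.natDegree ≤ 2 * 24 ∧ ∀ θ : ℝ,
      (hz (Function.update V e (κ θ)) m₀ z).adjugate p q =
        P.eval (cexp (θ * I)) * cexp (-((24 : ℕ) * θ * I)) := by
  have hM : ∀ i j : TorusSite 4 L × Fin 3 × Fin 4, ∃ P : ℂ[X], P.natDegree ≤
      2 * ((fun p : TorusSite 4 L × Fin 3 × Fin 4 =>
        (if p.1 = e.1 then 1 else 0) + (if p.1 = e.1.shift e.2 then 1 else 0)) i) ∧ ∀ θ : ℝ,
      (fun θ => (hz (Function.update V e (κ θ)) m₀ z).updateRow q (Pi.single p 1)) θ i j =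
        P.eval (cexp (θ * I)) * cexp (-(((fun p : TorusSite 4 L × Fin 3 × Fin 4 =>
          (if p.1 = e.1 then 1 else 0) + (if p.1 = e.1.shift e.2 then 1 else 0)) i : ℕ) * θ * I)) := by
    intro i j
    by_cases hiq : i = q
    · obtain ⟨P, hP, hθ⟩ := tp_mono (Nat.zero_le _) (tp_const 0 ((Pi.single p 1 : _ → ℂ) j))
      refine ⟨P, hP, fun θ => ?_⟩
      rw [← hθ θ]
      simp only [hiq, Matrix.updateRow_self]
    · obtain ⟨P, hP, hθ⟩ := tp_sub (tp_const_mul ((![1, 1, -1, -1] : Fin 4 → ℂ) i.2.2)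
        (tp_wilsonDirac_apply V e κ hκ m₀ 1 i j)) (tp_const _ (z * (1 : Matrix _ _ ℂ) i j))
      refine ⟨P, hP, fun θ => ?_⟩
      rw [← hθ θ]
      simp only [Matrix.updateRow_ne hiq, hz, Matrix.sub_apply, Matrix.smul_apply, smul_eq_mul,
        spinorLift_gammaFive_eq_diagonal, Matrix.diagonal_mul]
  obtain ⟨P, hP, hPθ⟩ := tp_det _ _ hM
  rw [sum_rowDegree e] at hP hPθ
  refine ⟨P, hP, fun θ => ?_⟩
  rw [Matrix.adjugate_apply]
  exact hPθ θ

/-- **Band limit of the cofactor block.** Along a one-link curve `κ` with entries in `T(1)`, the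
block `ℓ²`-sum `Σ_u |adj(H(V[e ↦ κ(t)]) − z)_{(x,u.1),(y,u.2)}|²` is a trigonometric polynomial of
degree `≤ 48`, uniformly in `L`, `V`, `e`, `m₀`, `z`, `x`, `y`. -/
theorem bandAdj [NeZero L] (V : GaugeConfig 4 L SU3) (e : Edge 4 L) (κ : ℝ → SU3)
    (hκ : ∀ a b : Fin 3, ∃ p : ℂ[X], p.natDegree ≤ 2 * 1 ∧ ∀ θ : ℝ,
      (κ θ : Matrix (Fin 3) (Fin 3) ℂ) a b = p.eval (cexp (θ * I)) * cexp (-((1 : ℕ) * θ * I)))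
    (m₀ : ℝ) (z : ℂ) (x y : TorusSite 4 L) :
    ∃ a : ℤ → ℂ, ∀ t : ℝ, ((∑ u : (Fin 3 × Fin 4) × (Fin 3 × Fin 4),
        ‖(hz (Function.update V e (κ t)) m₀ z).adjugate (x, u.1) (y, u.2)‖ ^ 2 : ℝ) : ℂ) =
      ∑ k ∈ Finset.Icc (-((48 : ℕ) : ℤ)) ((48 : ℕ) : ℤ), a k * cexp ((k : ℂ) * (t : ℂ) * I) := by
  have h := fun u : (Fin 3 × Fin 4) × (Fin 3 × Fin 4) => tp_adjugate V e κ hκ m₀ z (x, u.1) (y, u.2)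
  obtain ⟨Q, hQ, hQθ⟩ := tp_sum Finset.univ
    (fun (u : (Fin 3 × Fin 4) × (Fin 3 × Fin 4)) (θ : ℝ) =>
      (hz (Function.update V e (κ θ)) m₀ z).adjugate (x, u.1) (y, u.2) *
        star ((hz (Function.update V e (κ θ)) m₀ z).adjugate (x, u.1) (y, u.2)))
    fun u _ => tp_mul (h u) (tp_star (h u))
  refine fourier ⟨Q, hQ, fun t => ?_⟩
  rw [← hQθ t, Complex.ofReal_sum]
  refine Finset.sum_congr rfl fun u _ => ?_
  rw [← Complex.normSq_eq_norm_sq, ← Complex.mul_conj]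
  rfl

/-! ### Bookkeeping: the block index, the scale, Markov -/

/-- The four-fold colour–spin sum is a sum over `(Fin 3 × Fin 4) × (Fin 3 × Fin 4)`. -/
theorem sum_four (g : Fin 3 × Fin 4 → Fin 3 × Fin 4 → ℝ) :
    ∑ a : Fin 3, ∑ i : Fin 4, ∑ b : Fin 3, ∑ j : Fin 4, g (a, i) (b, j) =
      ∑ u : (Fin 3 × Fin 4) × (Fin 3 × Fin 4), g u.1 u.2 := by
  simp only [Fintype.sum_prod_type]

/-- A scale `ε₀ > 0` at which the small-ball bound `C ε₀ ^ c` is at most `1/2`. -/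
theorem exists_scale {C c : ℝ} (hC : 0 < C) (hc : 0 < c) :
    ∃ ε₀ : ℝ, 0 < ε₀ ∧ C * ε₀ ^ c ≤ 1 / 2 := by
  refine ⟨(1 / (2 * C)) ^ c⁻¹, Real.rpow_pos_of_pos (by positivity) _, ?_⟩
  rw [Real.rpow_inv_rpow (by positivity) hc.ne', mul_one_div, div_mul_cancel_right₀ hC.ne']
  norm_num

/-- **Small ball ⇒ one-point bound** (Markov on the complement).  On a probability space, if
`F ≥ 0` has `F²` integrable and the relative small ball `{F ≤ ε₀ F(W₀)}` has mass `≤ 1/2`, then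
`(ε₀ F(W₀))² ≤ 2 ∫ F²`. -/
theorem sq_mul_le_of_smallBall {Ω : Type*} [MeasurableSpace Ω] {μ : Measure Ω}
    [IsProbabilityMeasure μ] {F : Ω → ℝ} (hF0 : ∀ W, 0 ≤ F W)
    (hFi : Integrable (fun W => F W ^ 2) μ) {ε₀ : ℝ} (hε₀ : 0 ≤ ε₀) (W₀ : Ω)
    (hsb : (μ {W | F W ≤ ε₀ * F W₀}).toReal ≤ 1 / 2) :
    (ε₀ * F W₀) ^ 2 ≤ 2 * ∫ W, F W ^ 2 ∂μ := by
  rw [← measureReal_def] at hsb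
  have hM := mul_meas_ge_le_integral_of_nonneg (Eventually.of_forall fun W => sq_nonneg (F W)) hFi
    ((ε₀ * F W₀) ^ 2)
  have hsub : {W | F W ≤ ε₀ * F W₀}ᶜ ⊆ {W | (ε₀ * F W₀) ^ 2 ≤ F W ^ 2} := by
    intro W hW
    simp only [Set.mem_compl_iff, Set.mem_setOf_eq, not_le] at hW ⊢
    exact pow_le_pow_left₀ (mul_nonneg hε₀ (hF0 W₀)) hW.le 2
  have h1 : (1 : ℝ) ≤ μ.real {W | F W ≤ ε₀ * F W₀} + μ.real {W | (ε₀ * F W₀) ^ 2 ≤ F W ^ 2} :=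
    calc (1 : ℝ) = μ.real Set.univ := probReal_univ.symm
      _ = μ.real ({W | F W ≤ ε₀ * F W₀} ∪ {W | F W ≤ ε₀ * F W₀}ᶜ) := by rw [Set.union_compl_self]
      _ ≤ μ.real {W | F W ≤ ε₀ * F W₀} + μ.real {W | F W ≤ ε₀ * F W₀}ᶜ := measureReal_union_le _ _
      _ ≤ _ := add_le_add le_rfl (measureReal_mono hsub (measure_ne_top μ _))
  have hA : 1 / 2 ≤ μ.real {W | (ε₀ * F W₀) ^ 2 ≤ F W ^ 2} := by linarith
  calc (ε₀ * F W₀) ^ 2 = 2 * ((ε₀ * F W₀) ^ 2 * (1 / 2)) := by ring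
    _ ≤ 2 * ((ε₀ * F W₀) ^ 2 * μ.real {W | (ε₀ * F W₀) ^ 2 ≤ F W ^ 2}) := by gcongr
    _ ≤ 2 * ∫ W, F W ^ 2 ∂μ := by linarith

end AdjugateNikolskii

open SmallBall AdjugateNikolskii Summit.QuantumFields.QCD.Theorems in
/-- STUB `cubeAdjugateNikolskii` (Nikolskii / reverse Hölder for the cofactor block on the cube
fibre).  There is an absolute `K > 0` such that for every torus `L ≥ 4`, mass, spectral parameter,
sites `x, y`, background `U` and fibre point `W₀`, the square of the `ℓ¹` colour–spin block
`Σ_{a,i,b,j} |adj(H(refit W₀) − z)_{(x,a,i),(y,b,j)}|` is at most `K` times the product-Haar mean of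
the same square over the fibre — uniformly in everything (the constant depends only on the degree
`48` and the number `≤ 10⁴` of listed links). -/
theorem stub_cubeAdjugateNikolskii : ∃ K : ℝ, 0 < K ∧ ∀ (L : ℕ) [NeZero L], 4 ≤ L →
    ∀ (m₀ : ℝ) (z : ℂ) (x y : TorusSite 4 L) (U W₀ : GaugeConfig 4 L SU3),
    (∑ a : Fin 3, ∑ i : Fin 4, ∑ b : Fin 3, ∑ j : Fin 4,
        ‖(hz (refit (touches x y) U W₀) m₀ z).adjugate (x, a, i) (y, b, j)‖) ^ 2 ≤
      K * ∫ W, (∑ a : Fin 3, ∑ i : Fin 4, ∑ b : Fin 3, ∑ j : Fin 4,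
        ‖(hz (refit (touches x y) U W) m₀ z).adjugate (x, a, i) (y, b, j)‖) ^ 2 ∂(haarPi L) := by
  obtain ⟨T, hT⟩ := CircleTransport.exists_diagCircle
  obtain ⟨C, c, hC, hc, hFS⟩ := CircleTransport.stub_haarSmallBalls T hT
    (CircleTransport.stub_eulerWord T hT) (CircleTransport.stub_torusSmallBalls
      CircleTransport.stub_circleEngine.1 CircleTransport.stub_circleEngine.2) 48 10000
  obtain ⟨ε₀, hε₀, hCε₀⟩ := exists_scale hC hc
  have hK0 : (0 : ℝ) ≤ 144 * (2 / ε₀ ^ 2) := by positivity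
  refine ⟨144 * (2 / ε₀ ^ 2), by positivity, ?_⟩
  intro L _ _hL m₀ z x y U W₀
  obtain ⟨r, hcover⟩ := exists_listing x y
  set S : Edge 4 L → Bool := touches x y with hS
  -- the adjugate, its block `ℓ²`-sum `Q`, `G = √Q`, and the block `ℓ¹`-sum `Φ`
  set M : GaugeConfig 4 L SU3 →
      Matrix (TorusSite 4 L × Fin 3 × Fin 4) (TorusSite 4 L × Fin 3 × Fin 4) ℂ :=
    fun W => (hz (refit S U W) m₀ z).adjugate with hM
  set Q : GaugeConfig 4 L SU3 → ℝ := fun W =>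
    ∑ u : (Fin 3 × Fin 4) × (Fin 3 × Fin 4), ‖M W (x, u.1) (y, u.2)‖ ^ 2 with hQ
  set G : GaugeConfig 4 L SU3 → ℝ := fun W => Real.sqrt (Q W) with hG
  set Φ : GaugeConfig 4 L SU3 → ℝ := fun W =>
    ∑ a : Fin 3, ∑ i : Fin 4, ∑ b : Fin 3, ∑ j : Fin 4, ‖M W (x, a, i) (y, b, j)‖ with hΦ
  show Φ W₀ ^ 2 ≤ 144 * (2 / ε₀ ^ 2) * ∫ W, Φ W ^ 2 ∂haarPi L
  haveI : IsProbabilityMeasure (haarPi L) := by dsimp only [haarPi]; infer_instance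
  -- continuity
  have hrefit : Continuous fun W : GaugeConfig 4 L SU3 => refit S U W := by
    refine continuous_pi fun e => ?_
    by_cases h : S e = true
    · simp only [refit, h, ↓reduceIte]; exact continuous_apply e
    · simp only [refit, h, Bool.false_eq_true, ↓reduceIte]; exact continuous_const
  have hMc : Continuous M :=
    ((continuous_const.matrix_mul ((continuous_wilsonDirac (fundamentalRep (Fin 3))
      (continuous_fundamentalRep (Fin 3)) m₀ 1).comp hrefit)).sub continuous_const).matrix_adjugate
  have hQc : Continuous Q := continuous_finsetSum _ fun u _ => (hMc.matrix_elem _ _).norm.pow 2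
  have hGc : Continuous G := hQc.sqrt
  have hΦc : Continuous Φ :=
    continuous_finsetSum _ fun a _ => continuous_finsetSum _ fun i _ =>
      continuous_finsetSum _ fun b _ => continuous_finsetSum _ fun j _ => (hMc.matrix_elem _ _).norm
  have hQ0 : ∀ W, 0 ≤ Q W := fun W => Finset.sum_nonneg fun u _ => sq_nonneg _
  have hG0 : ∀ W, 0 ≤ G W := fun W => Real.sqrt_nonneg _
  have hG2 : ∀ W, G W ^ 2 = Q W := fun W => Real.sq_sqrt (hQ0 W)
  have hΦu : ∀ W, Φ W = ∑ u : (Fin 3 × Fin 4) × (Fin 3 × Fin 4), ‖M W (x, u.1) (y, u.2)‖ :=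
    fun W => sum_four fun s s' => ‖M W (x, s) (y, s')‖
  have hcard : (((Finset.univ : Finset ((Fin 3 × Fin 4) × (Fin 3 × Fin 4))).card : ℕ) : ℝ) = 144 := by
    simp
  have hΦQ : ∀ W, Φ W ^ 2 ≤ 144 * Q W := fun W => by
    rw [hΦu W, ← hcard]
    exact sq_sum_le_card_mul_sum_sq
  have hQΦ : ∀ W, Q W ≤ Φ W ^ 2 := fun W => by
    rw [hΦu W]
    exact Finset.sum_sq_le_sq_sum_of_nonneg fun u _ => norm_nonneg _
  -- the refit reads only listed links; `refit ∘ update = update ∘ refit`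
  have hupd : ∀ (e : Edge 4 L) (W : GaugeConfig 4 L SU3) (g : SU3),
      refit S U (Function.update W e g) = Function.update (refit S U W) e (if S e then g else U e) := by
    intro e W g
    funext e'
    by_cases h : e' = e
    · subst h; simp only [refit, Function.update_self]
    · simp only [refit, Function.update_of_ne h]
  have hdep : ∀ W W' : GaugeConfig 4 L SU3, (∀ i, W (r i) = W' (r i)) → G W = G W' := by
    intro W W' h
    have : refit S U W = refit S U W' := by
      funext e
      by_cases he : S e = true
      · obtain ⟨i, rfl⟩ := hcover e he
        simp only [refit, he, ↓reduceIte, h i]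
      · simp only [refit, he, Bool.false_eq_true, ↓reduceIte]
    simp only [hG, hQ, hM, this]
  -- the band limit of `G² = Q` along every two-sided circle at a listed link
  have hband : ∀ (W : GaugeConfig 4 L SU3) (i : (Bool × Bool) × (Fin 4 → Fin 5) × Fin 4) (A B : SU3),
      ∃ a : ℤ → ℂ, ∀ t : ℝ, ((G (Function.update W (r i) (A * T t * B)) ^ 2 : ℝ) : ℂ) =
        ∑ k ∈ Finset.Icc (-((48 : ℕ) : ℤ)) ((48 : ℕ) : ℤ),
          a k * Complex.exp ((k : ℂ) * (t : ℂ) * Complex.I) := by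
    intro W i A B
    have hκ : ∀ a b : Fin 3, ∃ p : Polynomial ℂ, p.natDegree ≤ 2 * 1 ∧ ∀ θ : ℝ,
        ((if S (r i) then A * T θ * B else U (r i) : SU3) :
          Matrix (Fin 3) (Fin 3) ℂ) a b = p.eval (Complex.exp (θ * Complex.I)) *
            Complex.exp (-((1 : ℕ) * θ * Complex.I)) := by
      intro a b
      by_cases h : S (r i) = true
      · simp only [h, ↓reduceIte]; exact tp1_circle hT A B a b
      · simp only [h, Bool.false_eq_true, ↓reduceIte]; exact SingleLinkLogFlatness.tp_const 1 _
    obtain ⟨a, ha⟩ := bandAdj (refit S U W) (r i) _ hκ m₀ z x y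
    refine ⟨a, fun t => ?_⟩
    rw [← ha t, hG2]
    simp only [hQ, hM, hupd]
  -- integrability on the compact probability space
  have hGi : Integrable (fun W => G W ^ 2) (haarPi L) :=
    TiltedFlatnessNegative.integrable_of_continuous (hGc.pow 2)
  have hΦi : Integrable (fun W => Φ W ^ 2) (haarPi L) :=
    TiltedFlatnessNegative.integrable_of_continuous (hΦc.pow 2)
  -- Nikolskii for `G` from the relative small ball at the scale `ε₀`
  have hGW₀ : G W₀ ^ 2 ≤ 2 / ε₀ ^ 2 * ∫ W, G W ^ 2 ∂haarPi L := by
    rcases (hG0 W₀).eq_or_lt with h0 | hpos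
    · rw [← h0, zero_pow two_ne_zero]
      exact mul_nonneg (div_nonneg zero_le_two (sq_nonneg _)) (integral_nonneg fun W => sq_nonneg _)
    · have hsb := hFS (Edge 4 L) ((Bool × Bool) × (Fin 4 → Fin 5) × Fin 4) r (by simp) G hGc hG0
        hdep hband W₀ hpos ε₀ hε₀
      have h := sq_mul_le_of_smallBall hG0 hGi hε₀.le W₀ (hsb.trans hCε₀)
      rw [div_mul_eq_mul_div, le_div_iff₀ (pow_pos hε₀ 2)]
      calc G W₀ ^ 2 * ε₀ ^ 2 = (ε₀ * G W₀) ^ 2 := by ring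
        _ ≤ _ := h
  calc Φ W₀ ^ 2 ≤ 144 * Q W₀ := hΦQ W₀
    _ = 144 * G W₀ ^ 2 := by rw [hG2]
    _ ≤ 144 * (2 / ε₀ ^ 2 * ∫ W, G W ^ 2 ∂haarPi L) := by gcongr
    _ = 144 * (2 / ε₀ ^ 2) * ∫ W, Q W ∂haarPi L := by simp_rw [hG2]; ring
    _ ≤ 144 * (2 / ε₀ ^ 2) * ∫ W, Φ W ^ 2 ∂haarPi L :=
        mul_le_mul_of_nonneg_left (integral_mono_of_nonneg (Eventually.of_forall hQ0) hΦi
          (Eventually.of_forall hQΦ)) hK0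

end Summit.QuantumFields.QCD.Cruxes.FrameAPrioriBound.CubeCofactor

end
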